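import Summits.QuantumAdvantage.QuantumAdvantage.Theorems.MobiusLadderLiouvilleNotTC0
import Literature.NumberTheory.Sieve.MoebiusWalshCircuitsProofs

/-!
# Stub `stub_shiftPairsCube` (rung R4) of line `Sketch` for the crux `ArithStatLadder.IqThreeNotPPoly`

**Shifted pairs are bit-`j`-sensitive points of the cube.** For `A ⊆ ℕ`, a position `j < n` and the
language `bin A = encodingNatBool.toLanguage A` of canonical (least-significant-digit-first) binary
numerals of members of `A`, every numeral `N ∈ [2^{n-1}, 2ⁿ)` with bit `j` equal to `0`, `N ∈ A` and
`N + 2ʲ ∉ A` yields a point `x = (N.testBit i)_{i<n}` of the cube `{0,1}ⁿ` at which the indicator of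
`bin A` changes when bit `j` is flipped; and `N ↦ x` is injective on `[0, 2ⁿ)`. Hence the number of
such `N` is at most the number of bit-`j`-sensitive points.

Ingredients: the digit map is inverted by `bitsToNat ∘ List.ofFn` on `[0, 2ⁿ)`
(`MoebiusWalsh.bitsToNat_ofFn_testBit`); a digit vector of length `n = k + 1` of `N < 2ⁿ` lies in
`bin A` iff `2ᵏ ≤ N ∧ N ∈ A` (`MobiusLadder.ofFn_testBit_mem_toLanguage_iff`); and, when bit `j` of
`N` is `0`, adding `2ʲ` sets bit `j` and changes no other bit (no carry:
`shiftPairsCube_testBit_add_two_pow`), so the flipped vector is the digit vector of `N + 2ʲ`, which is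
still in `[2^{n-1}, 2ⁿ)`.

## References

* S. Arora, B. Barak, *Computational Complexity: A Modern Approach*, CUP 2009, §1.2 (languages of
  encodings). [AroraBarakCC2009]
* R. O'Donnell, *Analysis of Boolean Functions*, CUP 2014, §2.2 (sensitivity / influence of a
  coordinate). [ODonnell2014]
-/

set_option linter.dupNamespace false -- D-0017: single-problem summit ⇒ `QuantumAdvantage.QuantumAdvantage` by design

noncomputable section

namespace Summit.QuantumAdvantage.QuantumAdvantage.Theorems.IqThreeNotPPoly

open scoped Classical
open Finset
open _root_.Computability
open Literature.Computability.Complexity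
open Literature.NumberTheory.Sieve.MoebiusWalsh (bitsToNat_ofFn_testBit ofFn_testBit_bitsToNat testBit_bitsToNat_ofFn bitsToNat_ofFn_lt)
open Summit.QuantumAdvantage.QuantumAdvantage.Theorems.MobiusLadder (ofFn_testBit_mem_toLanguage_iff testBit_eq_true_of_two_pow_le)

/-- **No carry.** If bit `j` of `N` is `0`, then the bits of `N + 2ʲ` are those of `N` except that
bit `j` becomes `1`. (Write `N = 2^{j+1} a + b` with `b < 2^{j+1}`; bit `j` of `b` is bit `j` of `N`,
so `b < 2ʲ`, and `N + 2ʲ = 2^{j+1} a + (2ʲ + b)` with `2ʲ + b < 2^{j+1}`; read off all bits with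
`Nat.testBit_two_pow_mul_add`.) [folklore] -/
theorem shiftPairsCube_testBit_add_two_pow {N j : ℕ} (hj : N.testBit j = false) (i : ℕ) :
    (N + 2 ^ j).testBit i = if i = j then true else N.testBit i := by
  -- Euclidean decomposition of `N` by `2^(j+1)`
  set a : ℕ := N / 2 ^ (j + 1) with ha
  set b : ℕ := N % 2 ^ (j + 1) with hb
  have hN : N = 2 ^ (j + 1) * a + b := (Nat.div_add_mod N (2 ^ (j + 1))).symm
  have hb_lt : b < 2 ^ (j + 1) := Nat.mod_lt _ (Nat.two_pow_pos _)
  have hbitN : ∀ t : ℕ,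
      N.testBit t = if t < j + 1 then b.testBit t else a.testBit (t - (j + 1)) := by
    intro t
    conv_lhs => rw [hN]
    exact Nat.testBit_two_pow_mul_add a hb_lt t
  -- bit `j` of `b` is bit `j` of `N`, hence `0`, so in fact `b < 2^j`
  have hbj : b.testBit j = false := by
    have h := hbitN j
    rw [if_pos (Nat.lt_succ_self j)] at h
    rw [← h, hj]
  have hb_lt' : b < 2 ^ j := by
    refine Nat.lt_pow_two_of_testBit b fun t ht => ?_
    rcases Nat.eq_or_lt_of_le ht with rfl | hlt
    · exact hbj
    · exact Nat.testBit_lt_two_pow (hb_lt.trans_le (Nat.pow_le_pow_right Nat.two_pos hlt))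
  have hc_lt : 2 ^ j + b < 2 ^ (j + 1) := by rw [Nat.pow_succ]; omega
  have hM : N + 2 ^ j = 2 ^ (j + 1) * a + (2 ^ j + b) := by rw [hN]; ring
  rw [hM, Nat.testBit_two_pow_mul_add a hc_lt i, hbitN i]
  by_cases hij : i < j + 1
  · rw [if_pos hij, if_pos hij]
    rcases Nat.lt_succ_iff_lt_or_eq.1 hij with hlt | rfl
    · rw [if_neg hlt.ne, Nat.testBit_two_pow_add_gt hlt]
    · rw [if_pos rfl, Nat.testBit_two_pow_add_eq, hbj, Bool.not_false]
  · rw [if_neg hij, if_neg hij, if_neg (by omega)]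

/-- If bit `j` of `N < 2ⁿ` is `0` then `N + 2ʲ < 2ⁿ` as well (`j < n`): all bits of `N + 2ʲ` from
position `n` on vanish. [folklore] -/
theorem shiftPairsCube_add_two_pow_lt {n N j : ℕ} (hN : N < 2 ^ n) (hjn : j < n)
    (hj : N.testBit j = false) : N + 2 ^ j < 2 ^ n :=
  Nat.lt_pow_two_of_testBit _ fun i hi => by
    rw [shiftPairsCube_testBit_add_two_pow hj, if_neg (by omega)]
    exact Nat.testBit_lt_two_pow (hN.trans_le (Nat.pow_le_pow_right Nat.two_pos hi))

/-- Flipping the (zero) digit `j` of the digit vector of `N` gives the digit vector of `N + 2ʲ`.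
[folklore] -/
theorem shiftPairsCube_update_testBit {n N : ℕ} (j : Fin n) (hj : N.testBit j = false) :
    Function.update (fun i : Fin n => N.testBit i) j (!N.testBit j) =
      fun i : Fin n => (N + 2 ^ (j : ℕ)).testBit i := by
  funext i
  rw [Function.update_apply, shiftPairsCube_testBit_add_two_pow hj, hj, Bool.not_false]
  by_cases hij : i = j
  · subst hij
    rw [if_pos rfl, if_pos rfl]
  · rw [if_neg hij, if_neg (Fin.val_ne_of_ne hij)]

/-- **RUNG STUB R4 · `stub_shiftPairsCube`.** For every `A ⊆ ℕ` and `j < n`, the numerals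
`N ∈ [2^{n-1}, 2ⁿ)` with bit `j` zero, `N ∈ A` and `N + 2ʲ ∉ A` inject (by `N ↦ (N.testBit i)_{i<n}`)
into the points of the cube `{0,1}ⁿ` at which the indicator of
`bin A = encodingNatBool.toLanguage A` is sensitive to bit `j`: the digit vector of such an `N` is the
codeword `encodeNat N ∈ bin A` (top digit `1`), while flipping its digit `j` gives the digit vector of
`N + 2ʲ ∈ [2^{n-1}, 2ⁿ)`, the codeword of a non-member. (O'Donnell 2014, §2.2: sensitivity of a
coordinate; Arora–Barak 2009, §1.2: languages of binary encodings.) -/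
theorem stub_shiftPairsCube :
    ∀ (n : ℕ) (j : Fin n) (A : Set ℕ),
      ((Finset.range (2 ^ n)).filter (fun N : ℕ =>
          2 ^ (n - 1) ≤ N ∧ N.testBit j = false ∧ N ∈ A ∧ N + 2 ^ (j : ℕ) ∉ A)).card ≤
        (Finset.univ.filter (fun x : Fin n → Bool =>
          (encodingNatBool.toLanguage A).boolIndicator (List.ofFn x) ≠
            (encodingNatBool.toLanguage A).boolIndicator
              (List.ofFn (Function.update x j (!x j))))).card := by
  intro n j A
  -- `n = k + 1` since `j < n`
  obtain ⟨k, rfl⟩ : ∃ k, n = k + 1 := ⟨n - 1, by have := j.isLt; omega⟩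
  refine Finset.card_le_card_of_injOn (fun N : ℕ => fun i : Fin (k + 1) => N.testBit i)
    (fun N hN => ?_) (fun N₁ h₁ N₂ h₂ h => ?_)
  · -- the digit vector of an admissible `N` is a bit-`j`-sensitive point
    obtain ⟨hNr, hNlo, hNj, hNA, hNA'⟩ := Finset.mem_filter.1 (Finset.mem_coe.1 hN)
    have hNlt : N < 2 ^ (k + 1) := Finset.mem_range.1 hNr
    rw [Nat.add_sub_cancel] at hNlo
    refine Finset.mem_coe.2 (Finset.mem_filter.2 ⟨Finset.mem_univ _, ?_⟩)
    have hMlt : N + 2 ^ (j : ℕ) < 2 ^ (k + 1) := shiftPairsCube_add_two_pow_lt hNlt j.isLt hNj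
    -- the digit vector of `N` is a codeword of a member of `A` (as sets of words:
    -- `Language Bool` is `Set (List Bool)` and the two memberships agree definitionally)
    have h1 : (encodingNatBool.toLanguage A).boolIndicator
        (List.ofFn fun i : Fin (k + 1) => N.testBit i) = true :=
      (Set.mem_iff_boolIndicator _ _).1
        (((ofFn_testBit_mem_toLanguage_iff A hNlt).2 ⟨hNlo, hNA⟩ :) :)
    -- the digit vector of `N + 2ʲ` is the codeword of a non-member
    have h2 : (encodingNatBool.toLanguage A).boolIndicator
        (List.ofFn fun i : Fin (k + 1) => (N + 2 ^ (j : ℕ)).testBit i) = false :=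
      (Set.notMem_iff_boolIndicator _ _).1 fun h =>
        hNA' ((ofFn_testBit_mem_toLanguage_iff A hMlt).1 h).2
    have key : (encodingNatBool.toLanguage A).boolIndicator
          (List.ofFn fun i : Fin (k + 1) => N.testBit i) ≠
        (encodingNatBool.toLanguage A).boolIndicator
          (List.ofFn (Function.update (fun i : Fin (k + 1) => N.testBit i) j (!N.testBit j))) := by
      rw [shiftPairsCube_update_testBit j hNj, h1, h2]
      decide
    exact key
  · -- injectivity of the digit map on `[0, 2ⁿ)`
    have h₁' : N₁ < 2 ^ (k + 1) := Finset.mem_range.1 (Finset.mem_filter.1 (Finset.mem_coe.1 h₁)).1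
    have h₂' : N₂ < 2 ^ (k + 1) := Finset.mem_range.1 (Finset.mem_filter.1 (Finset.mem_coe.1 h₂)).1
    have h' : bitsToNat (List.ofFn fun i : Fin (k + 1) => N₁.testBit i) =
        bitsToNat (List.ofFn fun i : Fin (k + 1) => N₂.testBit i) :=
      congrArg (fun x : Fin (k + 1) → Bool => bitsToNat (List.ofFn x)) h
    rwa [bitsToNat_ofFn_testBit h₁', bitsToNat_ofFn_testBit h₂'] at h'

end Summit.QuantumAdvantage.QuantumAdvantage.Theorems.IqThreeNotPPoly
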